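import Summits.MatrixMultiplication.MatrixMultiplication.Theses.MarginalColumns

/-!
# `ConcavityDominates` (route `MarginalColumns`, support item stmt-MatrixMultiplication-16312)

`TowerConcavity → SecondColumnDominates`: if the column tower `w ↦ T n w := R̲⟨n,n,w⟩` is concave
(`T n (w+2) + T n w ≤ 2·T n (w+1)`), then no marginal exceeds the first one
(`T n (w+1) + T n 1 ≤ T n w + T n 2`), by induction on `w ≥ 1` (telescoping the marginals).
Pure `ℕ` bookkeeping; the same induction as `dominates_of_concaveSplit` of the crux's birth
skeleton (`Cruxes/SecondColumnDominates/Lines/birth.lean`), without the diagonal case split.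

Landed by the line lead of crux stmt-MatrixMultiplication-16310 (line `Sketch`).
-/

set_option linter.dupNamespace false

noncomputable section

namespace Summit.MatrixMultiplication.MatrixMultiplication.Theorems

open Literature.Computability.AlgebraicComplexity
open Summit.MatrixMultiplication.MatrixMultiplication.Theses.MarginalColumns

/-- **Concavity of the column tower implies that the second column dominates** (induction on
`w ≥ 1`: `D(1)` is an equality, and `D(w)` plus concavity at `w` gives `D(w+1)`). [folklore] -/
theorem concavityDominates_proof : ConcavityDominates := by
  unfold ConcavityDominates TowerConcavity SecondColumnDominates
  intro hC n w hn hw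
  induction w, hw using Nat.le_induction with
  | base =>
      have e : (1 : ℕ) + 1 = 2 := rfl
      rw [e, Nat.add_comm]
  | succ w hw ih =>
      have hc := hC n w hn hw
      have e : w + 1 + 1 = w + 2 := rfl
      rw [e]
      omega

end Summit.MatrixMultiplication.MatrixMultiplication.Theorems

end
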